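import Summits.QuantumFields.YangMills.Theorems.SwapVirialDeficitSwapRingDeficitDefs
import Summits.QuantumFields.YangMills.Theorems.VirialFluxGapFixSplitDefs
import HarnessLib

/-!
# The RING CHART of the joint blow-up (brick J3 of memo-24197-massive-mode-rung), I: definitions — the follower index `Fol L`
# (`6L⁴ − 3` letters), the reconstruction map `ringConfig χ : (Fin 4 → SU(2)) × (Fol L → SU(2)) → X_fix` and the σ-glued deficit in
# leader ∕ follower coordinates `chartDeficit`
# (free-hands support of ⟨stmt-QuantumFields-24197⟩ `SwapVirialDeficit.SwapGluedStiffness`)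

Problem-side definitions (no theorem, no `sorry`) for the EQUALITY form of the Fubini bookkeeping of
✓`SwapRing.ringMeasure_real_swapDeficit_le_le_box_of_box` (its letter translations `Ψ` and leader identification `Θ`, inverted):

* `isLead i` — the off-tree link `i = (x, μ)` of slice `0` is the LEADER `(−ê_μ, μ)` of its direction; `NonLead L`, `SeamRest L`
  (seam sites `≠ 0`) and the FOLLOWER INDEX `Fol L := NonLead L ⊕ ((Fin (2L−1) × Edge 3 L) ⊕ SeamRest L)` (`card = 6L⁴ − 3`,
  ✓`PeriodicRingFloor.card_nonleaders`);
* `letter C i` — the letter of an off-tree link (`C_μ` iff the link crosses `x_μ = −1`, else `1`), `sliceZero C V` (leaders `C_μ` at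
  `(−ê_μ, μ)`, every other off-tree link `letter · V_i`), `seamField χ c V` (`g 0 = c`, `g x = χ(x)·c·V_x` for `x ≠ 0`), and
  `ringConfig χ (C, U) = (w, (r, g))` with `w = sliceZero (C ∘ castSucc) U_A`, `r_j e = glue(w) e · U_(j,e)`, `g = seamField χ (C 3) U_C`
  — the tree-gauge coordinates of ✓`VirialFluxGap.FixSplit.FixSpace` REBUILT from four leaders `C : Fin 4 → SU(2)` (`C_0, C_1, C_2`, seam
  value `c = C 3`) and `6L⁴ − 3` followers, each follower RELATIVE to its box reference (so that the toron box of
  ✓`SwapRing.swapCommBox_of_swapRingDeficit` reads `‖U_i − 1‖_F ≤ 48L³√F`);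
* `fixHistory x = (glue x.1 ∷ x.2.1, x.2.2)` (the ring history of a tree-gauged point) and `chartDeficit L z χ q := F^S_z (fixHistory (ringConfig χ q))`.

The sequel ✓`SwapVirialDeficitBlowUpRingChart` proves that `ringConfig χ` carries `Haar⁴ ⊗ Haar^{Fol}` to `μ_fix` and hence
`μ_L{F^S_z ≤ s} = (Haar⁴ ⊗ Haar^{Fol}){chartDeficit ≤ s} = ∫ Haar^{Fol}{U | chartDeficit (C, U) ≤ s} dHaar⁴(C)` — the frame in which the
leader chart (J2) and the follower chart (J1, ✓`BlowUp.lintegral_haar_pi_eq_followerChart`) compose to the scaling identity (S).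
HONEST LABEL: definitions only; nothing about ⟨24197⟩ or any rung is proved; the Yang–Mills mass gap is NOT proved; no summit is proved by a
line.  Width seat ym-line-sfw-p2-w2 g57 (cell ym-idea-1, free hands).  References: [cite: Luscher1983, §2]; [cite: tHooft1979]; [folklore].
-/

set_option autoImplicit false

noncomputable section

open MeasureTheory
open Literature.MathematicalPhysics.QuantumFieldTheory hiding SU2
open Summit.QuantumFields.YangMills.Theorems.FemtoTransferGap
open Summit.QuantumFields.YangMills.Theorems.FemtoTransferGap.TT
open Summit.QuantumFields.YangMills.Theorems.VirialFluxGap.FixSplit (FixSpace)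

namespace Summit.QuantumFields.YangMills.Theorems.SwapVirialDeficit.BlowUpRing

variable (L : ℕ) [NeZero L]

/-- The LEADER TEST on off-tree links of slice `0`: `i = (x, μ)` is the wrap link `(−ê_μ, μ)` of its own direction. [cite: Luscher1983, §2] -/
def isLead {L : ℕ} (i : OffIdx L) : Bool := decide (i.1.1 = Pi.single i.1.2 (-1 : ZMod L))

/-- The non-leader off-tree links of slice `0` (`2L³ + 1 − 3` of them). [folklore] -/
abbrev NonLead : Type := {i : OffIdx L // ¬ isLead i = true}

/-- The seam sites other than the origin (`L³ − 1` of them). [folklore] -/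
abbrev SeamRest : Type := {x : Site 3 L // ¬ x = 0}

/-- The FOLLOWER INDEX of the tree-gauged `2L`-slice ring: non-leader off-tree links of slice `0`, all links of the slices `1 … 2L−1`,
seam sites `≠ 0` (`card = 6L⁴ − 3`). [folklore] -/
abbrev Fol : Type := NonLead L ⊕ ((Fin (2 * L - 1) × Edge 3 L) ⊕ SeamRest L)

/-- The LETTER of an off-tree link `i = (x, ν)` of slice `0` given leaders `C`: `C_ν` if the link crosses the plane `x_ν = −1`, else `1`
(the box reference of ✓`SwapRing.swapCommBox_of_swapRingDeficit`). [cite: Luscher1983, §2] -/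
def letter {L : ℕ} (C : Fin 3 → SU2) (i : OffIdx L) : SU2 := if i.1.1 i.1.2 = -1 then C i.1.2 else 1

/-- SLICE `0` REBUILT: the leader `C_μ` on `(−ê_μ, μ)`, and `letter · V_i` on every other off-tree link `i`. [folklore] -/
def sliceZero {L : ℕ} (C : Fin 3 → SU2) (V : NonLead L → SU2) : OffIdx L → SU2 :=
  fun i => if h : isLead i = true then C i.1.2 else letter C i * V ⟨i, h⟩

/-- THE SEAM FIELD REBUILT: `g 0 = c` and `g x = χ(x) · c · V_x` for `x ≠ 0` (`χ ≡ 1` in the principal sector). [folklore] -/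
def seamField {L : ℕ} (χ : Site 3 L → SU2) (c : SU2) (V : SeamRest L → SU2) : Site 3 L → SU2 :=
  fun x => if h : x = 0 then c else χ x * c * V ⟨x, h⟩

/-- ★ **THE RECONSTRUCTION MAP** `ringConfig χ (C, U) = (w, (r, g))`: `w = sliceZero (C ∘ castSucc) U|_A`, `r_j e = glue(w) e · U_(j,e)`,
`g = seamField χ (C 3) U|_C` — tree-gauge coordinates from four leaders and `6L⁴ − 3` relative followers. [folklore] -/
def ringConfig {L : ℕ} [NeZero L] (χ : Site 3 L → SU2) (q : (Fin 4 → SU2) × (Fol L → SU2)) : FixSpace L :=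
  (sliceZero (fun μ => q.1 (Fin.castSucc μ)) (fun i => q.2 (Sum.inl i)),
    ((fun j e => glue (sliceZero (fun μ => q.1 (Fin.castSucc μ)) (fun i => q.2 (Sum.inl i))) e * q.2 (Sum.inr (Sum.inl (j, e)))),
      seamField χ (q.1 (Fin.last 3)) (fun x => q.2 (Sum.inr (Sum.inr x)))))

/-- The ring history `(glue w ∷ r, g)` of a tree-gauged point `(w, (r, g))`. [folklore] -/
def fixHistory {L : ℕ} [NeZero L] (x : FixSpace L) : (Fin (2 * L - 1 + 1) → GaugeConfig 3 L SU2) × (Site 3 L → SU2) :=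
  ((Fin.cons (glue x.1) x.2.1 : Fin (2 * L - 1 + 1) → GaugeConfig 3 L SU2), x.2.2)

/-- ★ **The σ-glued deficit in leader ∕ follower coordinates**: `chartDeficit L z χ (C, U) = F^S_z (glue w ∷ r, g)` with `(w, (r, g)) = ringConfig χ (C, U)`.
[cite: tHooft1979] [cite: Luscher1983, §2] -/
def chartDeficit (z : Fin 3 → Bool) (χ : Site 3 L → SU2) (q : (Fin 4 → SU2) × (Fol L → SU2)) : ℝ :=
  SwapRing.swapRingDeficit L z (fixHistory (ringConfig χ q))

end Summit.QuantumFields.YangMills.Theorems.SwapVirialDeficit.BlowUpRing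

end
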